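import Summits.HodgeConjecture.CorCM.IrreducibleOddWeightsProductSpan
import Literature.AlgebraicGeometry.Pohlmann1968.HodgeClassesProductSpanCMProductsPowers
import HarnessLib

/-!
# The `n`-ary Moonen–Zarhin equivalence: `Hg(∏_i A_i) = ∏_i Hg(A_i)` IFF the Hodge classes of `(∏_j A_{π₁ j}) × (∏_j A_{π₂ j})`
# are exterior products for ALL disjoint products of copies — the converse of file G2

COR-CM (cell `pub-hodgecm2`, binder seat `b16` gen 60, count-neutral claim HODGE GLUING, file G7 — CM fields and their
realisations; theorems only, no definition, no named fact, no `sorry`).  NEW as stated, hence under `Summits/`.  HONEST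
FRAMING: an unconditional structure theorem on Hodge classes of products of CM abelian varieties; `HC_CM` is neither
used nor asserted.

G2 (`hodgeClassesProductSpan_biproduct_of_cmFamilyRank_add_card_eq`): an ADDITIVE family (`cmFamilyRank Φ + |I| =
Σ_i cmTypeRank Φ_i + 1`) has the product-span property for every pair of disjoint slot maps.  Here the converse:

* §1 `IrrOdd.typeRank_sum_comp_equiv` (the glued two-block rank is invariant under re-indexing both families along
  equivalences), `cmFamilyRank_subtype_eq_cmTypeRank` (a one-member family has the rank of its member),
  `typeRank_sum_singleton_erase_eq` (gluing `{i}` and `T ∖ {i}` gives the family `T`);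
  `exists_not_hodgeClassesProductSpan_of_typeRank_lt_fintype` — the tree's two-block converse
  `Pohlmann1968.exists_not_hodgeClassesProductSpan_pow_of_typeRank_lt` for base families over arbitrary finite index types.
* §2 **`exists_not_hodgeClassesProductSpan_of_cmFamilyRank_add_card_ne`** — if the family is NOT additive
  (`Hg(∏_i A_i) ⊊ ∏_i Hg(A_i)`), there are DISJOINT slot maps `π₁`, `π₂` (indeed `π₁` constant `= i`, `π₂` avoiding `i`)
  such that `(∏_j A_{π₁ j}) × (∏_j A_{π₂ j})` carries a rational Hodge class which is NOT a combination of exterior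
  products of Hodge classes of the two factors: a MINIMAL non-additive sub-family `T₀` (all smaller sub-families additive)
  is, against any member `i ∈ T₀`, two-block non-additive (`rank(Σ_{T₀}) + 1 < rank Φ_i + rank Σ_{T₀∖i}`, by the
  defect identity `δ(T₀) = ε({i}|T₀∖i) + δ(T₀∖i)`), and the two-block converse applies to `({i}, T₀ ∖ {i})`.
* **`cmFamilyRank_add_card_eq_iff_forall_hodgeClassesProductSpan`** — THE EQUIVALENCE: `Hg(∏_i A_i) = ∏_i Hg(A_i)` iff
  for all `N₁, N₂ ≥ 1` and all `π₁ : Fin N₁ → I`, `π₂ : Fin N₂ → I` with disjoint images,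
  `HodgeClassesProductSpan (⨁_j A_{π₁ j}) (⨁_j A_{π₂ j})` (Moonen–Zarhin (3.1) for `n` factors of CM type).

## References

* [MoonenZarhin1999LowDim] B. Moonen, Yu. Zarhin, *Hodge classes on abelian varieties of low dimension*, Math. Ann.
  315 (1999), §3 (3.1).
* [Gordon1999HodgeAVSurvey] B. B. Gordon, *A survey of the Hodge conjecture for abelian varieties*, 7.5–7.7.
* [Pohlmann1968] H. Pohlmann, *Algebraic cycles on abelian varieties of complex multiplication type*, Ann. of Math. 88
  (1968), Thm. 1.
-/

set_option autoImplicit false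

noncomputable section

open scoped BigOperators

open CategoryTheory CategoryTheory.Limits NumberField

namespace Summit.HodgeConjecture.CorCM

namespace IrrOdd

open Literature.NumberTheory.ComplexMultiplication

universe w

variable {G : Type w} [Group G]

/-- **The glued two-block rank is invariant under re-indexing both families along equivalences** (the glued types
correspond under the equivariant bijection `(j, s) ↦ (e j, s)` on each summand). [cite: Deligne1982HodgeCycles, I Ex. 3.7] -/
theorem typeRank_sum_comp_equiv {I₁ I₂ J₁ J₂ : Type*} {E₁ : I₁ → Type*} {E₂ : I₂ → Type*}
    [∀ i, MulAction G (E₁ i)] [∀ i, MulAction G (E₂ i)] (Φ₁ : ∀ i, Set (E₁ i)) (Φ₂ : ∀ i, Set (E₂ i))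
    (e₁ : J₁ ≃ I₁) (e₂ : J₂ ≃ I₂) :
    typeRank G {z : (Σ j, E₁ (e₁ j)) ⊕ (Σ j, E₂ (e₂ j)) |
        Sum.elim (· ∈ sigmaType fun j => Φ₁ (e₁ j)) (· ∈ sigmaType fun j => Φ₂ (e₂ j)) z} =
      typeRank G {z : (Σ i, E₁ i) ⊕ (Σ i, E₂ i) | Sum.elim (· ∈ sigmaType Φ₁) (· ∈ sigmaType Φ₂) z} := by
  set q : (Σ j, E₁ (e₁ j)) ⊕ (Σ j, E₂ (e₂ j)) → (Σ i, E₁ i) ⊕ (Σ i, E₂ i) :=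
    Sum.map (fun x => ⟨e₁ x.1, x.2⟩) (fun x => ⟨e₂ x.1, x.2⟩) with hq
  have hq_smul : ∀ (g : G) (z : (Σ j, E₁ (e₁ j)) ⊕ (Σ j, E₂ (e₂ j))), q (g • z) = g • q z := by
    intro g z
    rcases z with ⟨j, s⟩ | ⟨j, s⟩ <;> rfl
  have hq_surj : Function.Surjective q := by
    rintro (⟨i, s⟩ | ⟨i, s⟩)
    · obtain ⟨j, rfl⟩ := e₁.surjective i
      exact ⟨Sum.inl ⟨j, s⟩, rfl⟩
    · obtain ⟨j, rfl⟩ := e₂.surjective i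
      exact ⟨Sum.inr ⟨j, s⟩, rfl⟩
  have hq_pre : q ⁻¹' {z : (Σ i, E₁ i) ⊕ (Σ i, E₂ i) | Sum.elim (· ∈ sigmaType Φ₁) (· ∈ sigmaType Φ₂) z} =
      {z | Sum.elim (· ∈ sigmaType fun j => Φ₁ (e₁ j)) (· ∈ sigmaType fun j => Φ₂ (e₂ j)) z} := by
    ext z
    rcases z with ⟨j, s⟩ | ⟨j, s⟩ <;> rfl
  rw [← hq_pre]
  exact typeRank_preimage_eq_of_surjective (G := G) _ q hq_smul hq_surj

end IrrOdd

open Literature.NumberTheory.ComplexMultiplication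
open Literature.AlgebraicGeometry.Motives (AbelianVariety CMType)
open Literature.AlgebraicGeometry.Motives.AbelianVariety
open Literature.AlgebraicGeometry.HodgeTheory
open Literature.AlgebraicGeometry.ComplexMultiplication (IsCMTypeRealisation)
open Literature.AlgebraicGeometry.Milne1999 (flatIndex)
open Literature.AlgebraicGeometry.Pohlmann1968

/-! ### §1 One-member families, gluing a member to a sub-family, and the two-block converse for arbitrary index types -/

section Pieces

variable {I : Type} {K : I → Type} [∀ i, Field (K i)] [∀ i, NumberField (K i)] [∀ i, IsCMField (K i)]

omit [∀ i, NumberField (K i)] [∀ i, IsCMField (K i)] in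
/-- **A one-member family has the rank of its member**: `cmFamilyRank (Φ_j)_{j = i} = cmTypeRank Φ_i`
(`dim MT(A_i)` either way). [cite: Gordon1999HodgeAVSurvey, 7.6.1] -/
theorem cmFamilyRank_subtype_eq_cmTypeRank (Φ : ∀ i, CMType (K i)) (i : I) :
    CMAlgebra.cmFamilyRank (fun j : {j // j = i} => Φ j.1) = cmTypeRank (Φ i) := by
  set q : (K i →+* ℂ) → Σ j : {j // j = i}, (K j.1 →+* ℂ) := fun s => ⟨⟨i, rfl⟩, s⟩ with hq
  have hq_smul : ∀ (g : ℂ ≃+* ℂ) (s : K i →+* ℂ), q (g • s) = g • q s := fun g s => rfl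
  have hq_surj : Function.Surjective q := by
    rintro ⟨⟨j, hj⟩, s⟩
    subst hj
    exact ⟨s, rfl⟩
  have hq_pre : q ⁻¹' CMAlgebra.familyType (fun j : {j // j = i} => Φ j.1) = (Φ i).1 := rfl
  unfold CMAlgebra.cmFamilyRank cmTypeRank
  rw [← hq_pre]
  exact (typeRank_preimage_eq_of_surjective (G := ℂ ≃+* ℂ) _ q hq_smul hq_surj).symm

omit [∀ i, NumberField (K i)] [∀ i, IsCMField (K i)] in
/-- **Gluing the member `i ∈ T` to the sub-family `T ∖ {i}` gives the sub-family `T`** (in Kubota rank).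
[cite: Deligne1982HodgeCycles, I Ex. 3.7] -/
theorem typeRank_sum_singleton_erase_eq [DecidableEq I] (Φ : ∀ i, CMType (K i)) (T : Finset I) {i : I} (hi : i ∈ T) :
    typeRank (ℂ ≃+* ℂ) {z : (Σ _ : Fin 1, (K i →+* ℂ)) ⊕ (Σ j : {j // j ∈ T.erase i}, (K j.1 →+* ℂ)) |
        Sum.elim (· ∈ CMAlgebra.familyType fun _ : Fin 1 => Φ i)
          (· ∈ CMAlgebra.familyType fun j : {j // j ∈ T.erase i} => Φ j.1) z} =
      CMAlgebra.cmFamilyRank fun j : {j // j ∈ T} => Φ j.1 := by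
  set q : (Σ _ : Fin 1, (K i →+* ℂ)) ⊕ (Σ j : {j // j ∈ T.erase i}, (K j.1 →+* ℂ)) →
      Σ j : {j // j ∈ T}, (K j.1 →+* ℂ) :=
    Sum.elim (fun x => ⟨⟨i, hi⟩, x.2⟩) (fun x => ⟨⟨x.1.1, Finset.mem_of_mem_erase x.1.2⟩, x.2⟩) with hq
  have hq_smul : ∀ (g : ℂ ≃+* ℂ) (z : (Σ _ : Fin 1, (K i →+* ℂ)) ⊕ (Σ j : {j // j ∈ T.erase i}, (K j.1 →+* ℂ))),
      q (g • z) = g • q z := by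
    intro g z
    rcases z with ⟨k, s⟩ | ⟨⟨j, hj⟩, s⟩ <;> rfl
  have hq_surj : Function.Surjective q := by
    rintro ⟨⟨j, hj⟩, s⟩
    by_cases h : j = i
    · subst h
      exact ⟨Sum.inl ⟨0, s⟩, rfl⟩
    · exact ⟨Sum.inr ⟨⟨j, Finset.mem_erase.2 ⟨h, hj⟩⟩, s⟩, rfl⟩
  have hq_pre : q ⁻¹' CMAlgebra.familyType (fun j : {j // j ∈ T} => Φ j.1) =
      {z | Sum.elim (· ∈ CMAlgebra.familyType fun _ : Fin 1 => Φ i)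
        (· ∈ CMAlgebra.familyType fun j : {j // j ∈ T.erase i} => Φ j.1) z} := by
    ext z
    rcases z with ⟨k, s⟩ | ⟨⟨j, hj⟩, s⟩ <;> rfl
  unfold CMAlgebra.cmFamilyRank
  rw [← hq_pre]
  exact typeRank_preimage_eq_of_surjective (G := ℂ ≃+* ℂ) _ q hq_smul hq_surj

end Pieces

section Converse

variable {I₁ I₂ : Type} [Fintype I₁] [Fintype I₂] {K₁ : I₁ → Type} {K₂ : I₂ → Type}
  [∀ i, Field (K₁ i)] [∀ i, NumberField (K₁ i)] [∀ i, IsCMField (K₁ i)]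
  [∀ i, Field (K₂ i)] [∀ i, NumberField (K₂ i)] [∀ i, IsCMField (K₂ i)]
  {Φ₁ : ∀ i, CMType (K₁ i)} {Φ₂ : ∀ i, CMType (K₂ i)} {A₁ : I₁ → AbelianVariety ℂ} {A₂ : I₂ → AbelianVariety ℂ}
  {ι₁ : ∀ i, 𝓞 (K₁ i) →+* End (A₁ i)} {ι₂ : ∀ i, 𝓞 (K₂ i) →+* End (A₂ i)}
  {θ₁ : ∀ i, K₁ i →+* Module.End ℂ (complexBetti (A₁ i).X 1)}
  {θ₂ : ∀ i, K₂ i →+* Module.End ℂ (complexBetti (A₂ i).X 1)}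

/-- **The two-block converse for base families over arbitrary finite index types**: if
`rank(Σ₁ ⊔ Σ₂) + 1 < cmFamilyRank Φ₁ + cmFamilyRank Φ₂` (`Hg(X × Y) ⊊ Hg(X) × Hg(Y)`), then for some `a` and the
enumerations `e_r : Fin |I_r| ≃ I_r` the flattened powers `⨁_j A₁ (e₁ (κ j)) ≅ X^{a+1}`, `⨁_j A₂ (e₂ (κ j)) ≅ Y^{a+1}`
do NOT have the product-span property. [cite: MoonenZarhin1999LowDim, §3 (3.1)] [cite: Gordon1999HodgeAVSurvey, 7.5 (1) ⟹ (3)] -/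
theorem exists_not_hodgeClassesProductSpan_of_typeRank_lt_fintype [Nonempty I₁] [Nonempty I₂]
    (hA₁ : ∀ i, IsCMTypeRealisation (Φ₁ i) (A₁ i) (ι₁ i) (θ₁ i))
    (hA₂ : ∀ i, IsCMTypeRealisation (Φ₂ i) (A₂ i) (ι₂ i) (θ₂ i))
    (hlt : typeRank (ℂ ≃+* ℂ) {z : (Σ i, (K₁ i →+* ℂ)) ⊕ (Σ i, (K₂ i →+* ℂ)) |
        Sum.elim (· ∈ CMAlgebra.familyType Φ₁) (· ∈ CMAlgebra.familyType Φ₂) z} + 1 <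
      CMAlgebra.cmFamilyRank Φ₁ + CMAlgebra.cmFamilyRank Φ₂) :
    ∃ a : ℕ, ¬ HodgeClassesProductSpan
      (⨁ fun j : Fin ((a + 1) * Fintype.card I₁) => A₁ ((Fintype.equivFin I₁).symm (flatIndex a j)))
      (⨁ fun j : Fin ((a + 1) * Fintype.card I₂) => A₂ ((Fintype.equivFin I₂).symm (flatIndex a j))) := by
  classical
  set e₁ : Fin (Fintype.card I₁) ≃ I₁ := (Fintype.equivFin I₁).symm with he₁
  set e₂ : Fin (Fintype.card I₂) ≃ I₂ := (Fintype.equivFin I₂).symm with he₂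
  haveI : NeZero (Fintype.card I₁) := ⟨Fintype.card_ne_zero⟩
  haveI : NeZero (Fintype.card I₂) := ⟨Fintype.card_ne_zero⟩
  have hlt' : typeRank (ℂ ≃+* ℂ) {z : (Σ k, (K₁ (e₁ k) →+* ℂ)) ⊕ (Σ k, (K₂ (e₂ k) →+* ℂ)) |
      Sum.elim (· ∈ CMAlgebra.familyType fun k => Φ₁ (e₁ k)) (· ∈ CMAlgebra.familyType fun k => Φ₂ (e₂ k)) z} + 1 <
      CMAlgebra.cmFamilyRank (fun k => Φ₁ (e₁ k)) + CMAlgebra.cmFamilyRank (fun k => Φ₂ (e₂ k)) := by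
    rw [CMAlgebra.cmFamilyRank_comp_equiv Φ₁ e₁, CMAlgebra.cmFamilyRank_comp_equiv Φ₂ e₂]
    have h := IrrOdd.typeRank_sum_comp_equiv (G := ℂ ≃+* ℂ) (E₁ := fun i => K₁ i →+* ℂ) (E₂ := fun i => K₂ i →+* ℂ)
      (fun i => (Φ₁ i).1) (fun i => (Φ₂ i).1) e₁ e₂
    change typeRank (ℂ ≃+* ℂ) {z : (Σ k, (K₁ (e₁ k) →+* ℂ)) ⊕ (Σ k, (K₂ (e₂ k) →+* ℂ)) |
        Sum.elim (· ∈ sigmaType fun k => (Φ₁ (e₁ k)).1) (· ∈ sigmaType fun k => (Φ₂ (e₂ k)).1) z} =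
      typeRank (ℂ ≃+* ℂ) {z : (Σ i, (K₁ i →+* ℂ)) ⊕ (Σ i, (K₂ i →+* ℂ)) |
        Sum.elim (· ∈ sigmaType fun i => (Φ₁ i).1) (· ∈ sigmaType fun i => (Φ₂ i).1) z} at h
    change typeRank (ℂ ≃+* ℂ) {z : (Σ k, (K₁ (e₁ k) →+* ℂ)) ⊕ (Σ k, (K₂ (e₂ k) →+* ℂ)) |
        Sum.elim (· ∈ sigmaType fun k => (Φ₁ (e₁ k)).1) (· ∈ sigmaType fun k => (Φ₂ (e₂ k)).1) z} + 1 < _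
    rw [h]
    exact hlt
  exact exists_not_hodgeClassesProductSpan_pow_of_typeRank_lt (K := fun k => K₁ (e₁ k)) (K' := fun k => K₂ (e₂ k))
    (A := fun k => A₁ (e₁ k)) (A' := fun k => A₂ (e₂ k)) (fun k => hA₁ (e₁ k)) (fun k => hA₂ (e₂ k)) hlt'

end Converse

/-! ### §2 The `n`-ary equivalence -/

section Family

variable {I : Type} [Fintype I] [DecidableEq I] {K : I → Type} [∀ i, Field (K i)] [∀ i, NumberField (K i)]
  [∀ i, IsCMField (K i)] {Φ : ∀ i, CMType (K i)} {A : I → AbelianVariety ℂ} {ιA : ∀ i, 𝓞 (K i) →+* End (A i)}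
  {θ : ∀ i, K i →+* Module.End ℂ (complexBetti (A i).X 1)}

/-- **IF `Hg(∏_i A_i) ⊊ ∏_i Hg(A_i)` THEN SOME DISJOINT PRODUCT OF COPIES HAS AN EXCEPTIONAL MIXED CLASS.**  Realisations
`A_i ⊨ (K_i; Φ_i)` of a family which is NOT additive (`cmFamilyRank Φ + |I| ≠ Σ_i cmTypeRank Φ_i + 1`).  Then there are
slot maps `π₁ : Fin N₁ → I`, `π₂ : Fin N₂ → I` (`N₁, N₂ ≥ 1`) with disjoint images such that
`¬ HodgeClassesProductSpan (⨁_j A_{π₁ j}) (⨁_j A_{π₂ j})`: the product carries a rational Hodge class that is not a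
`ℂ`-combination of exterior products of Hodge classes of the two factors.  (A minimal non-additive sub-family `T₀` is
two-block non-additive against any of its members; then the two-block converse for `({i}, T₀ ∖ {i})`.)
[cite: MoonenZarhin1999LowDim, §3 (3.1)] [cite: Gordon1999HodgeAVSurvey, 7.5–7.7] -/
theorem exists_not_hodgeClassesProductSpan_of_cmFamilyRank_add_card_ne [Nonempty I]
    (hA : ∀ i, IsCMTypeRealisation (Φ i) (A i) (ιA i) (θ i))
    (hne : CMAlgebra.cmFamilyRank Φ + Fintype.card I ≠ (∑ i, cmTypeRank (Φ i)) + 1) :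
    ∃ (N₁ N₂ : ℕ) (_ : NeZero N₁) (_ : NeZero N₂) (π₁ : Fin N₁ → I) (π₂ : Fin N₂ → I),
      (∀ j₁ j₂, π₁ j₁ ≠ π₂ j₂) ∧ ¬ HodgeClassesProductSpan (⨁ fun j => A (π₁ j)) (⨁ fun j => A (π₂ j)) := by
  classical
  -- additivity of a sub-family `T`
  let add : Finset I → Prop := fun T =>
    CMAlgebra.cmFamilyRank (fun j : {j // j ∈ T} => Φ j.1) + T.card = (∑ j ∈ T, cmTypeRank (Φ j)) + 1
  -- the a-priori inequality for every non-empty `T`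
  have hle : ∀ T : Finset I, T.Nonempty →
      CMAlgebra.cmFamilyRank (fun j : {j // j ∈ T} => Φ j.1) + T.card ≤ (∑ j ∈ T, cmTypeRank (Φ j)) + 1 := by
    intro T hT
    obtain ⟨j₀, hj₀⟩ := hT
    haveI : Nonempty {j // j ∈ T} := ⟨⟨j₀, hj₀⟩⟩
    haveI : ∀ j : {j // j ∈ T}, Nonempty (K j.1 →+* ℂ) := fun j => inferInstance
    have h := typeRank_sigmaType_add_card_le (G := ℂ ≃+* ℂ) (E := fun j : {j // j ∈ T} => K j.1 →+* ℂ)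
      (Φ := fun j => (Φ j.1).1) fun j => isCMTypeWith_conj (Φ j.1)
    rw [Fintype.card_coe] at h
    have hsum : ∑ j : {j // j ∈ T}, typeRank (ℂ ≃+* ℂ) (Φ j.1).1 = ∑ j ∈ T, cmTypeRank (Φ j) :=
      Finset.sum_coe_sort T fun j => cmTypeRank (Φ j)
    rw [hsum] at h
    exact h
  -- the whole family is a non-additive sub-family
  have huniv : ¬ add Finset.univ := by
    intro h
    apply hne
    have hr : CMAlgebra.cmFamilyRank (fun j : {j // j ∈ (Finset.univ : Finset I)} => Φ j.1) =
        CMAlgebra.cmFamilyRank Φ :=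
      (CMAlgebra.cmFamilyRank_comp_of_surjective (fun j : {j // j ∈ (Finset.univ : Finset I)} => Φ j.1)
        (π := fun i : I => (⟨i, Finset.mem_univ i⟩ : {j // j ∈ (Finset.univ : Finset I)}))
        fun j => ⟨j.1, rfl⟩).symm.trans rfl
    have h' : CMAlgebra.cmFamilyRank (fun j : {j // j ∈ (Finset.univ : Finset I)} => Φ j.1) + Finset.univ.card =
        (∑ j ∈ Finset.univ, cmTypeRank (Φ j)) + 1 := h
    rw [hr, Finset.card_univ] at h'
    exact h'
  -- a non-additive sub-family of least cardinality among the non-empty ones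
  have hex : ∃ m, ∃ T : Finset I, T.Nonempty ∧ T.card = m ∧ ¬ add T :=
    ⟨_, Finset.univ, Finset.univ_nonempty, rfl, huniv⟩
  obtain ⟨T₀, hT₀ne, hT₀card, hT₀⟩ := Nat.find_spec hex
  have hmin : ∀ T : Finset I, T.Nonempty → T.card < T₀.card → add T := by
    intro T hT hlt
    by_contra hbad
    exact Nat.find_min hex (hT₀card ▸ hlt) ⟨T, hT, rfl, hbad⟩
  -- `T₀` has at least two members
  obtain ⟨i, hi⟩ := hT₀ne
  have hT₀2 : (T₀.erase i).Nonempty := by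
    rw [← Finset.card_pos, Finset.card_erase_of_mem hi]
    by_contra h0
    have h1 : T₀.card = 1 := by have := Finset.card_pos.2 ⟨i, hi⟩; omega
    obtain ⟨i', hi'⟩ := Finset.card_eq_one.1 h1
    subst hi'
    apply hT₀
    change CMAlgebra.cmFamilyRank (fun j : {j // j ∈ ({i'} : Finset I)} => Φ j.1) + ({i'} : Finset I).card =
      (∑ j ∈ ({i'} : Finset I), cmTypeRank (Φ j)) + 1
    rw [Finset.card_singleton, Finset.sum_singleton]
    have hr : CMAlgebra.cmFamilyRank (fun j : {j // j ∈ ({i'} : Finset I)} => Φ j.1) = cmTypeRank (Φ i') := by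
      rw [← cmFamilyRank_subtype_eq_cmTypeRank Φ i']
      refine (CMAlgebra.cmFamilyRank_comp_of_surjective (fun j : {j // j ∈ ({i'} : Finset I)} => Φ j.1)
        (π := fun j : {j // j = i'} => (⟨j.1, Finset.mem_singleton.2 j.2⟩ : {j // j ∈ ({i'} : Finset I)}))
        fun j => ⟨⟨j.1, Finset.mem_singleton.1 j.2⟩, rfl⟩).symm.trans rfl
    rw [hr]
  -- the two-block strict inequality for `({i}, T₀ ∖ {i})`
  haveI : Nonempty {j // j ∈ T₀.erase i} := by obtain ⟨j, hj⟩ := hT₀2; exact ⟨⟨j, hj⟩⟩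
  have herase : add (T₀.erase i) := hmin _ hT₀2 (Finset.card_erase_lt_of_mem hi)
  have hlt : typeRank (ℂ ≃+* ℂ) {z : (Σ _ : Fin 1, (K i →+* ℂ)) ⊕ (Σ j : {j // j ∈ T₀.erase i}, (K j.1 →+* ℂ)) |
      Sum.elim (· ∈ CMAlgebra.familyType fun _ : Fin 1 => Φ i)
        (· ∈ CMAlgebra.familyType fun j : {j // j ∈ T₀.erase i} => Φ j.1) z} + 1 <
      CMAlgebra.cmFamilyRank (fun _ : Fin 1 => Φ i) + CMAlgebra.cmFamilyRank (fun j : {j // j ∈ T₀.erase i} => Φ j.1) := by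
    rw [typeRank_sum_singleton_erase_eq Φ T₀ hi]
    have h1 : CMAlgebra.cmFamilyRank (fun _ : Fin 1 => Φ i) = cmTypeRank (Φ i) := by
      rw [← cmFamilyRank_subtype_eq_cmTypeRank Φ i]
      exact CMAlgebra.cmFamilyRank_comp_of_surjective (fun j : {j // j = i} => Φ j.1)
        (π := fun _ : Fin 1 => (⟨i, rfl⟩ : {j // j = i})) fun j => ⟨0, by obtain ⟨j, rfl⟩ := j; rfl⟩
    rw [h1]
    have h2 : ¬ (CMAlgebra.cmFamilyRank (fun j : {j // j ∈ T₀} => Φ j.1) + T₀.card =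
        (∑ j ∈ T₀, cmTypeRank (Φ j)) + 1) := hT₀
    have h3 := hle T₀ ⟨i, hi⟩
    have h4 : CMAlgebra.cmFamilyRank (fun j : {j // j ∈ T₀.erase i} => Φ j.1) + (T₀.erase i).card =
        (∑ j ∈ T₀.erase i, cmTypeRank (Φ j)) + 1 := herase
    have h5 := Finset.add_sum_erase T₀ (fun j => cmTypeRank (Φ j)) hi
    have h6 := Finset.card_erase_of_mem hi
    have h7 := Finset.card_pos.2 ⟨i, hi⟩
    omega
  -- the two-block converse
  obtain ⟨a, ha⟩ := exists_not_hodgeClassesProductSpan_of_typeRank_lt_fintype (K₁ := fun _ : Fin 1 => K i)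
    (K₂ := fun j : {j // j ∈ T₀.erase i} => K j.1) (Φ₁ := fun _ : Fin 1 => Φ i)
    (Φ₂ := fun j : {j // j ∈ T₀.erase i} => Φ j.1) (A₁ := fun _ : Fin 1 => A i)
    (A₂ := fun j : {j // j ∈ T₀.erase i} => A j.1) (fun _ => hA i) (fun j => hA j.1) hlt
  refine ⟨(a + 1) * Fintype.card (Fin 1), (a + 1) * Fintype.card {j // j ∈ T₀.erase i},
    ⟨Nat.mul_ne_zero (Nat.succ_ne_zero a) Fintype.card_ne_zero⟩,
    ⟨Nat.mul_ne_zero (Nat.succ_ne_zero a) Fintype.card_ne_zero⟩, fun _ => i,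
    fun j => ((Fintype.equivFin {j // j ∈ T₀.erase i}).symm (flatIndex a j)).1, fun j₁ j₂ h => ?_, ha⟩
  exact (Finset.mem_erase.1 ((Fintype.equivFin {j // j ∈ T₀.erase i}).symm (flatIndex a j₂)).2).1 h.symm

/-- **THE `n`-ARY MOONEN–ZARHIN EQUIVALENCE FOR CM PRODUCTS.**  Realisations `A_i ⊨ (K_i; Φ_i)` (`i ∈ I` finite
non-empty) of ARBITRARY CM types.  `Hg(∏_i A_i) = ∏_i Hg(A_i)` (additivity `cmFamilyRank Φ + |I| = Σ_i cmTypeRank Φ_i + 1`)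
IF AND ONLY IF for all `N₁, N₂ ≥ 1` and all slot maps `π₁ : Fin N₁ → I`, `π₂ : Fin N₂ → I` with disjoint images, every
rational Hodge class on `(∏_j A_{π₁ j}) × (∏_j A_{π₂ j})` is a `ℂ`-combination of exterior products of rational Hodge
classes of the two factors (`HodgeClassesProductSpan`).  (⟹ file G2; ⟸ above.)
[cite: MoonenZarhin1999LowDim, §3 (3.1)] [cite: Gordon1999HodgeAVSurvey, 7.5–7.7] -/
theorem cmFamilyRank_add_card_eq_iff_forall_hodgeClassesProductSpan [Nonempty I]
    (hA : ∀ i, IsCMTypeRealisation (Φ i) (A i) (ιA i) (θ i)) :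
    CMAlgebra.cmFamilyRank Φ + Fintype.card I = (∑ i, cmTypeRank (Φ i)) + 1 ↔
      ∀ (N₁ N₂ : ℕ) [NeZero N₁] [NeZero N₂] (π₁ : Fin N₁ → I) (π₂ : Fin N₂ → I), (∀ j₁ j₂, π₁ j₁ ≠ π₂ j₂) →
        HodgeClassesProductSpan (⨁ fun j => A (π₁ j)) (⨁ fun j => A (π₂ j)) := by
  refine ⟨fun hadd N₁ N₂ _ _ π₁ π₂ hdisj =>
    hodgeClassesProductSpan_biproduct_of_cmFamilyRank_add_card_eq hadd hA π₁ π₂ hdisj, fun h => ?_⟩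
  by_contra hne
  obtain ⟨N₁, N₂, hN₁, hN₂, π₁, π₂, hdisj, hnot⟩ := exists_not_hodgeClassesProductSpan_of_cmFamilyRank_add_card_ne hA hne
  exact hnot (h N₁ N₂ π₁ π₂ hdisj)

end Family

end Summit.HodgeConjecture.CorCM

end
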